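import Literature.AlgebraicGeometry.Motives.PolynomialPointCountsBettiNumbers
import Literature.AlgebraicGeometry.Motives.PointCountFormulaBettiNumbers
import Literature.AlgebraicGeometry.Motives.ZetaFunctionOfProjectiveSpaceOverBase
import Literature.AlgebraicGeometry.Motives.SegreEmbedding
import Literature.AlgebraicGeometry.Motives.TateConjectureExtremeCodimensions
import Literature.AlgebraicGeometry.Motives.LefschetzStarProofs
import HarnessLib

/-!
# The cohomology of `ℙⁿ` and of `X × ℙⁿ` over a finite field in a Galois Weil cohomology:
# `b_{2r}(ℙⁿ) = 1` (`r ≤ n`), `b_odd(ℙⁿ) = 0`, `F = qʳ` on `H^{2r}(ℙⁿ)`, `P_{2r}(ℙⁿ, T) = 1 − qʳT`,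
# and the projective bundle formula `b_i(X × ℙⁿ) = Σ_{a ≤ min(n, i/2)} b_{i−2a}(X)`

Topic `Literature/AlgebraicGeometry/Motives`; THEOREMS ONLY (no definition, no instance, no named fact;
D-0026).  For a Galois Weil cohomology `E` over a finite field `k` (`q = #k`) with the Lefschetz trace formula
and `χ(φ) = q` (the setting of `Motives/PolynomialPointCountsBettiNumbers`, `Motives/PointCountFormulaBettiNumbers`,
`Motives/TateConjectureExtremeCodimensions`), this file instantiates the tree's «polynomial point count ⟹
cohomology» machinery at `X = ℙⁿ` (`#ℙⁿ(𝔽_{q^m}) = Σ_{r ≤ n} q^{rm}`, `Motives/ZetaFunctionOfProjectiveSpace`)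
and at `X × ℙⁿ` (`#(X × ℙⁿ)(𝔽_{q^m}) = (1 + q^m + ⋯ + q^{nm}) #X(𝔽_{q^m})`,
`Motives/ZetaFunctionOfProjectiveSpaceOverBase`).  The Riemann hypothesis for `ℙⁿ` (resp. `X`, `X × ℙⁿ`) IN `E`
(`E.WeilRiemannHypothesisFor`) is a hypothesis throughout, as in those files (it identifies the
`Pᵢ = det(1 − TF | Hⁱ)` inside `Z(X, T)`); nothing else is assumed — in particular the conclusions «all classes
on `ℙⁿ` are algebraic», `Tʳ(ℙⁿ)` and `D(ℙⁿ)` are PROVED from the hyperplane class, not assumed.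

## Sources, read on the page

R. Hartshorne, *Algebraic Geometry* [Hartshorne1977], App. C Ex. 5.2 «`Z(𝐏ⁿ, t) = 1/((1−t)(1−qt)⋯(1−qⁿt))`.
Verify the Weil conjectures for `Pⁿ`» (held copy p0524), (1.3) «`Pᵢ(t) = det(1 − f*t; Hⁱ(X, ℚ_ℓ))` … the Betti
numbers», (4.1)–(4.3) (the cohomological interpretation: `Pᵢ(t) = det(1 − f*t | Hⁱ)`; `f*` on `H^{2r}`).
L. Göttsche, *Hilbert schemes of zero-dimensional subschemes of smooth varieties* [Gottsche1993], §1.2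
Remark 1.2.2 (held copy p0030): «`|X(𝐅_{qⁿ})| = F(qⁿ, |S(𝐅_{qⁿ})|, …)` … Then `p(X̄, −z) = F(z², p(S̄, −z), …)`»
— `F(t) = 1 + t + ⋯ + tⁿ` for `ℙⁿ` (`b_{2r}(ℙⁿ) = 1`, `b_odd = 0`), `F(t, s) = (1 + t + ⋯ + tⁿ) s` for `X × ℙⁿ → X`
(`p(X × ℙⁿ, z) = (1 + z² + ⋯ + z^{2n}) p(X, z)`).
S. Kleiman, *Algebraic cycles and the Weil conjectures* [Kleiman1968], §1.2 (C) (cycle classes; `γ` multiplicative,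
the class of a linear subspace `Lʳ ⊂ ℙⁿ` is `ηʳ`, `η` the hyperplane class; `deg ηⁿ > 0`), §3 (`∼_hom` vs `∼_num`).
J. Tate, *Conjectures on algebraic cycles in ℓ-adic cohomology* [Tate1994], §1 (Conjecture `Tʳ`; the twist
`H^{2r}(X)(r)`).  P. Deligne, *La conjecture de Weil. I* [Deligne1974], (1.5.4), Th. (1.6).

## What is here (`E`, `hE : E.HasLefschetzTraceFormula`, `hχ : χ(φ) = q`, `hRH` the Riemann hypothesis in `E`)

* §1 the point counts in the normal forms of the two machinery files: `pointCount_projectiveSpace_cast`,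
  `pointCount_tensor_projectiveSpace_cast` (`A = 0`, `B = 1 + T + ⋯ + Tⁿ`); private `coeff_sum_X_pow`.
* §2 `ℙⁿ`: **`finrank_projectiveSpace_two_mul`** (`b_{2r}(ℙⁿ) = 1`, `r ≤ n`), `finrank_projectiveSpace_of_odd`
  (`b_odd = 0`), **`finrank_projectiveSpace`** (`bᵢ(ℙⁿ) = [i even ∧ i ≤ 2n]`),
  **`frobCharPoly_projectiveSpace_two_mul`** (`det(1 − TF | H^{2r}(ℙⁿ)) = 1 − qʳT`),
  `charpoly_frobAction_projectiveSpace_two_mul` (`det(T − F) = T − qʳ`), **`frobAction_projectiveSpace_two_mul`**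
  (`F = qʳ` on `H^{2r}(ℙⁿ)`), `ρTwist_projectiveSpace_two_mul_eq_one` (the twisted Frobenius `q^{−r}F` is the
  identity on `H^{2r}(ℙⁿ)(r)`), **`algebraicClasses_projectiveSpace_eq_top`** (every class on `ℙⁿ` is algebraic:
  `H^{2r}(ℙⁿ) = K·ηʳ`), **`tateConjectureFor_projectiveSpace`** (`Tʳ(ℙⁿ/𝔽_q)` for all `r`),
  `standardConjectureD_projectiveSpace` (`hom = num` on `ℙⁿ`).
* §3 `X × ℙⁿ` (`X` smooth projective of dimension `d`; `hXRH`, and `hRH` for `X × ℙⁿ` in dimension `d + n`):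
  `isSmoothProjective_tensor_projectiveSpace` (`X × ℙⁿ` smooth projective of dimension `d + n`, the tree's
  `IsSmoothProjective.tensor_holds`), **`finrank_tensor_projectiveSpace`** (the projective bundle ∕ Künneth
  formula `bᵢ(X × ℙⁿ) = Σ_{a ≤ i/2, a ≤ n} b_{i−2a}(X)`), `finrank_tensor_projectiveSpace_eq_zero_of_odd`,
  `finrank_tensor_projectiveSpace_of_lt_two` (`b₀`, `b₁` unchanged).

HC is not touched.

## References

* [Hartshorne1977] R. Hartshorne, *Algebraic Geometry*, GTM 52 (1977), App. C (1.3), §4, Ex. 5.2.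
* [Gottsche1993] L. Göttsche, *Hilbert schemes of zero-dimensional subschemes of smooth varieties*, LNM 1572
  (1994), §1.2 Remark 1.2.2.
* [Kleiman1968] S. L. Kleiman, *Algebraic cycles and the Weil conjectures*, in: Dix exposés (1968), §1.2 (C), §3.
* [Tate1994] J. Tate, *Conjectures on algebraic cycles in ℓ-adic cohomology*, PSPM 55.1 (1994), §1.
* [Deligne1974] P. Deligne, *La conjecture de Weil. I*, Publ. Math. IHÉS 43 (1974), (1.5.4), Th. (1.6).
* Tree: `Motives/PolynomialPointCountsBettiNumbers` (g44-#2), `Motives/PointCountFormulaBettiNumbers`,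
  `Motives/TateConjectureExtremeCodimensions` (g37-#5), `Motives/LefschetzStarProofs`, `Motives/SegreEmbedding`,
  `Motives/ZetaFunctionOfProjectiveSpace` (g48-#1), `Motives/ZetaFunctionOfProjectiveSpaceOverBase` (g48-#8).

## Provenance

Lane `lit-hodgefound` (summit `HodgeConjecture`, Track 2 foundations library, Layer B: motives / Weil
cohomology over finite fields), seat `lit-hodgefound-p29` (literature-prover, generation 48, row g48-#11).
-/

universe u v

open Polynomial CategoryTheory MonoidalCategory

noncomputable section

namespace Literature.AlgebraicGeometry.Motives

namespace GaloisWeilCohomology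

open Literature.NumberTheory.LFunctions

variable {k : Type u} [Field k] [Finite k] {K : Type v} [Field K] [CharZero K]
  {χ : Field.absoluteGaloisGroup k →* Kˣ} (E : GaloisWeilCohomology k K χ)

/-! ### §1 The point counts of `ℙⁿ` and `X × ℙⁿ` in the polynomial-count normal forms -/

omit [CharZero K] in
/-- `#ℙⁿ(𝔽_{q^m}) = Σ_{r ≤ n} 1 · q^{rm}` in `ℚ` (the tree's `pointCount_projectiveSpace`, cast; the shape of the
hypothesis of `Motives/PolynomialPointCountsBettiNumbers`). [cite: Hartshorne1977, App. C Ex. 5.2] -/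
theorem pointCount_projectiveSpace_cast {n m : ℕ} (hm : 0 < m) :
    (pointCount (projectiveSpace n k) m : ℚ) =
      ∑ r ∈ Finset.range (n + 1), (fun _ => (1 : ℚ)) r * (Nat.card k : ℚ) ^ (r * m) := by
  rw [pointCount_projectiveSpace hm, Nat.cast_sum]
  exact Finset.sum_congr rfl fun r _ => by rw [Nat.cast_pow, one_mul, mul_comm]

omit [CharZero K] in
/-- `#(X × ℙⁿ)(𝔽_{q^m}) = 0 + (Σ_{a ≤ n} (q^m)^a) · #X(𝔽_{q^m})` in `ℚ` (the tree's `pointCount_tensor_projectiveSpace`;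
the shape `A(q^m) + B(q^m) #S(𝔽_{q^m})` of `Motives/PointCountFormulaBettiNumbers` with `A = 0`,
`B = 1 + T + ⋯ + Tⁿ`). [cite: Gottsche1993, §1.2 Remark 1.2.2] -/
theorem pointCount_tensor_projectiveSpace_cast (X : SchemeOver k) {n m : ℕ} (hm : 0 < m) :
    (pointCount (X ⊗ projectiveSpace n k) m : ℚ) =
      (0 : ℚ[X]).eval ((Nat.card k : ℚ) ^ m) +
        (∑ a ∈ Finset.range (n + 1), (Polynomial.X : ℚ[X]) ^ a).eval ((Nat.card k : ℚ) ^ m) *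
          (pointCount X m : ℚ) := by
  rw [pointCount_tensor_projectiveSpace X hm, eval_zero, zero_add, eval_finsetSum, Nat.cast_mul, Nat.cast_sum,
    mul_comm]
  refine congrArg (· * _) (Finset.sum_congr rfl fun a _ => ?_)
  rw [eval_pow, eval_X, Nat.cast_pow, pow_mul]

omit [Field k] [Finite k] [CharZero K] in
/-- The coefficients of `1 + T + ⋯ + Tⁿ`. [folklore] -/
private theorem coeff_sum_X_pow (n a : ℕ) :
    (∑ b ∈ Finset.range (n + 1), (Polynomial.X : ℚ[X]) ^ b).coeff a = if a ≤ n then 1 else 0 := by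
  rw [finsetSum_coeff]
  simp_rw [coeff_X_pow]
  rw [Finset.sum_ite_eq]
  simp [Finset.mem_range]

/-! ### §2 The cohomology of `ℙⁿ`: Betti numbers, Frobenius, `P_{2r}(ℙⁿ, T)` -/

section ProjectiveSpace

variable {n : ℕ}

/-- **`b_{2r}(ℙⁿ) = 1` for `r ≤ n`**, for a Galois Weil cohomology `E` over the finite field `k` with the Lefschetz
trace formula and `χ(φ) = q`, granted the Riemann hypothesis for `ℙⁿ` in `E` (`#ℙⁿ(𝔽_{q^m}) = Σ_{r ≤ n} q^{rm}`
and the tree's `finrank_eq_of_pointCount_eq_sum`; Hartshorne App. C Ex. 5.2 «Verify the Weil conjectures for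
`Pⁿ`», Göttsche Remark 1.2.2: `b_{2r} = [tʳ]F`). [cite: Hartshorne1977, App. C Ex. 5.2] [cite: Gottsche1993, §1.2 Remark 1.2.2] -/
theorem finrank_projectiveSpace_two_mul (hE : E.HasLefschetzTraceFormula)
    (hχ : ((χ (arithFrob k) : Kˣ) : K) = Nat.card k)
    (hRH : E.WeilRiemannHypothesisFor (projectiveSpace n k) n) {r : ℕ} (hr : r ≤ n) :
    Module.finrank K (E.obj (projectiveSpace n k) (2 * r)) = 1 := by
  have h := E.finrank_eq_of_pointCount_eq_sum hE hχ (isSmoothProjective_projectiveSpace_holds k n) hRH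
    (fun _ hm => pointCount_projectiveSpace_cast hm) hr
  exact_mod_cast h

/-- **`b_i(ℙⁿ) = 0` for `i` odd** (granted the Riemann hypothesis for `ℙⁿ` in `E`).
[cite: Hartshorne1977, App. C Ex. 5.2] [cite: Gottsche1993, §1.2 Remark 1.2.2] -/
theorem finrank_projectiveSpace_of_odd (hE : E.HasLefschetzTraceFormula)
    (hχ : ((χ (arithFrob k) : Kˣ) : K) = Nat.card k)
    (hRH : E.WeilRiemannHypothesisFor (projectiveSpace n k) n) {i : ℕ} (hi : Odd i) :
    Module.finrank K (E.obj (projectiveSpace n k) i) = 0 :=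
  E.finrank_eq_zero_of_odd_of_pointCount_eq_sum hE hχ (isSmoothProjective_projectiveSpace_holds k n) hRH
    (fun _ hm => pointCount_projectiveSpace_cast hm) hi

/-- **The Betti numbers of `ℙⁿ`: `b_i(ℙⁿ) = 1` if `i` is even and `i ≤ 2n`, `0` otherwise** (granted the
Riemann hypothesis for `ℙⁿ` in `E`). [cite: Hartshorne1977, App. C Ex. 5.2] [cite: Gottsche1993, §1.2 Remark 1.2.2] -/
theorem finrank_projectiveSpace (hE : E.HasLefschetzTraceFormula)
    (hχ : ((χ (arithFrob k) : Kˣ) : K) = Nat.card k)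
    (hRH : E.WeilRiemannHypothesisFor (projectiveSpace n k) n) (i : ℕ) :
    Module.finrank K (E.obj (projectiveSpace n k) i) = if Even i ∧ i ≤ 2 * n then 1 else 0 := by
  split_ifs with h
  · obtain ⟨⟨r, hr⟩, hi⟩ := h
    rw [hr, ← two_mul]
    exact E.finrank_projectiveSpace_two_mul hE hχ hRH (by omega)
  · by_cases hi : Even i
    · exact E.finrank_obj_eq_zero (isSmoothProjective_projectiveSpace_holds k n) (by
        have := not_and.mp h hi; omega)
    · exact E.finrank_projectiveSpace_of_odd hE hχ hRH (Nat.not_even_iff_odd.mp hi)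

/-- **`P_{2r}(ℙⁿ, T) = det(1 − T·F | H^{2r}(ℙⁿ)) = 1 − qʳT` for `r ≤ n`** (granted the Riemann hypothesis for `ℙⁿ`
in `E`; Hartshorne App. C Ex. 5.2). [cite: Hartshorne1977, App. C Ex. 5.2 and (1.3)] -/
theorem frobCharPoly_projectiveSpace_two_mul (hE : E.HasLefschetzTraceFormula)
    (hχ : ((χ (arithFrob k) : Kˣ) : K) = Nat.card k)
    (hRH : E.WeilRiemannHypothesisFor (projectiveSpace n k) n) {r : ℕ} (hr : r ≤ n) :
    E.frobCharPoly (projectiveSpace n k) (2 * r) = 1 - C ((Nat.card k : K) ^ r) * Polynomial.X := by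
  rw [E.frobCharPoly_eq_pow_of_pointCount_eq_sum hE hχ (isSmoothProjective_projectiveSpace_holds k n) hRH
    (fun _ hm => pointCount_projectiveSpace_cast hm) r, E.finrank_projectiveSpace_two_mul hE hχ hRH hr, pow_one]

/-- **`det(T − F | H^{2r}(ℙⁿ)) = T − qʳ` for `r ≤ n`**. [cite: Hartshorne1977, App. C Ex. 5.2 and (1.3)] -/
theorem charpoly_frobAction_projectiveSpace_two_mul (hE : E.HasLefschetzTraceFormula)
    (hχ : ((χ (arithFrob k) : Kˣ) : K) = Nat.card k)
    (hRH : E.WeilRiemannHypothesisFor (projectiveSpace n k) n) {r : ℕ} (hr : r ≤ n) :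
    (haveI := E.finite_obj (isSmoothProjective_projectiveSpace_holds k n) (2 * r);
      (E.frobAction (projectiveSpace n k) (2 * r)).charpoly) = Polynomial.X - C ((Nat.card k : K) ^ r) := by
  rw [E.charpoly_frobAction_eq_pow_of_pointCount_eq_sum hE hχ (isSmoothProjective_projectiveSpace_holds k n) hRH
    (fun _ hm => pointCount_projectiveSpace_cast hm) r, E.finrank_projectiveSpace_two_mul hE hχ hRH hr, pow_one]

/-- **The Frobenius acts on `H^{2r}(ℙⁿ)` as the scalar `qʳ`** (`r ≤ n`; Cayley–Hamilton on the line `H^{2r}(ℙⁿ)`).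
[cite: Hartshorne1977, App. C Ex. 5.2 and (1.3)] [cite: Deligne1974, (1.5.4) and Th. (1.6)] -/
theorem frobAction_projectiveSpace_two_mul (hE : E.HasLefschetzTraceFormula)
    (hχ : ((χ (arithFrob k) : Kˣ) : K) = Nat.card k)
    (hRH : E.WeilRiemannHypothesisFor (projectiveSpace n k) n) {r : ℕ} (hr : r ≤ n) :
    E.frobAction (projectiveSpace n k) (2 * r) =
      algebraMap K (Module.End K (E.obj (projectiveSpace n k) (2 * r))) ((Nat.card k : K) ^ r) := by
  have h := E.frobAction_sub_pow_eq_zero_of_pointCount_eq_sum hE hχ (isSmoothProjective_projectiveSpace_holds k n)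
    hRH (fun _ hm => pointCount_projectiveSpace_cast hm) r
  rw [E.finrank_projectiveSpace_two_mul hE hχ hRH hr, pow_one, sub_eq_zero] at h
  exact h

/-- **The twisted Frobenius `φ_r = q^{−r}F` is the identity on `H^{2r}(ℙⁿ)(r)`** (`r ≤ n`): every class of
`H^{2r}(ℙⁿ)(r)` is a Tate class. [cite: Tate1994, §1 and §2 Th. 2.9] [cite: Hartshorne1977, App. C Ex. 5.2] -/
theorem ρTwist_projectiveSpace_two_mul_eq_one (hE : E.HasLefschetzTraceFormula)
    (hχ : ((χ (arithFrob k) : Kˣ) : K) = Nat.card k)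
    (hRH : E.WeilRiemannHypothesisFor (projectiveSpace n k) n) {r : ℕ} (hr : r ≤ n) :
    E.ρTwist (projectiveSpace n k) (2 * r) r (geomFrob k) = 1 := by
  have hq : ((Nat.card k : K) ^ r) ≠ 0 := pow_ne_zero r (by exact_mod_cast Nat.card_pos.ne')
  rw [E.ρTwist_geomFrob_natCast, coe_χ_geomFrob hχ, E.frobAction_projectiveSpace_two_mul hE hχ hRH hr,
    Algebra.algebraMap_eq_smul_one, smul_smul, inv_pow, inv_mul_cancel₀ hq, one_smul]

/-- **All cohomology classes on `ℙⁿ` are algebraic: `K·Aʳ(ℙⁿ) = H^{2r}(ℙⁿ)` for every `r`** (granted the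
Riemann hypothesis for `ℙⁿ` in `E`, which makes `H^{2r}(ℙⁿ)` a line for `r ≤ n`): the power `ηʳ` of a hyperplane
class is algebraic (the tree's `pow_mem_algebraicClasses`, `hyperplaneClass_mem_algebraicClasses`) and non-zero
since `ηʳ ∪ η^{n−r} = ηⁿ ≠ 0` (`tr ηⁿ = deg ℙⁿ > 0`, `exists_isHyperplaneClass_pow_ne_zero`, `cup_pow_pow`); beyond
`2n` the groups vanish. (Kleiman 1968 §1.2 (C): `γ(Lʳ) = ηʳ` for a linear subspace; Tate's `T(ℙⁿ)`.)
[cite: Kleiman1968, §1.2 (C)] [cite: Tate1994, §1 Conjecture T^r] [cite: Hartshorne1977, App. C Ex. 5.2] -/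
theorem algebraicClasses_projectiveSpace_eq_top (hE : E.HasLefschetzTraceFormula)
    (hχ : ((χ (arithFrob k) : Kˣ) : K) = Nat.card k)
    (hRH : E.WeilRiemannHypothesisFor (projectiveSpace n k) n) (r : ℕ) :
    E.algebraicClasses (projectiveSpace n k) r = ⊤ := by
  have hP := isSmoothProjective_projectiveSpace_holds k n
  rcases Nat.lt_or_ge n r with hnr | hrn
  · haveI := E.subsingleton_obj hP (show 2 * n < 2 * r by omega)
    exact eq_top_iff.2 fun x _ => by rw [Subsingleton.elim x 0]; exact Submodule.zero_mem _
  · rcases Nat.eq_zero_or_pos n with hn0 | hn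
    · obtain rfl : r = 0 := by omega
      exact E.algebraicClasses_zero_eq_top_univ hP
    obtain ⟨η, hη, hne⟩ := E.exists_isHyperplaneClass_pow_ne_zero hP hn
    have hr_ne : E.pow (projectiveSpace n k) η r ≠ 0 := by
      intro h0
      apply hne
      rw [← E.cup_pow_pow hP η r (n - r) n (by omega) (by omega), h0, LinearMap.map_zero₂]
    have hmem : E.pow (projectiveSpace n k) η r ∈ E.algebraicClasses (projectiveSpace n k) r :=
      E.pow_mem_algebraicClasses hP (E.hyperplaneClass_mem_algebraicClasses hP hη) r
    haveI := E.finite_obj hP (2 * r)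
    rw [eq_top_iff]
    rintro x -
    obtain ⟨c, hc⟩ := (finrank_eq_one_iff_of_nonzero' (E.pow (projectiveSpace n k) η r) hr_ne).mp
      (E.finrank_projectiveSpace_two_mul hE hχ hRH hrn) x
    rw [← hc]
    exact Submodule.smul_mem _ c hmem

/-- **The Tate conjecture `Tʳ(ℙⁿ/𝔽_q)` holds for every `r`** (in `E`, granted the Riemann hypothesis for `ℙⁿ` in
`E`): `K·Aʳ(ℙⁿ) = (H^{2r}(ℙⁿ)(r))^{Γ_k}`, both being all of `H^{2r}(ℙⁿ)`.
[cite: Tate1994, §1 Conjecture T^r] [cite: Kleiman1968, §1.2 (C)] -/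
theorem tateConjectureFor_projectiveSpace (hE : E.HasLefschetzTraceFormula)
    (hχ : ((χ (arithFrob k) : Kˣ) : K) = Nat.card k)
    (hRH : E.WeilRiemannHypothesisFor (projectiveSpace n k) n) (r : ℕ) :
    E.TateConjectureFor (projectiveSpace n k) r :=
  le_antisymm (E.algebraicClasses_le_invariants (isSmoothProjective_projectiveSpace_holds k n) r) (by
    rw [E.algebraicClasses_projectiveSpace_eq_top hE hχ hRH r]
    exact le_top)

/-- **`D(ℙⁿ)`: homological and numerical equivalence agree on `ℙⁿ`** (every class is algebraic; the tree's
`standardConjectureD_of_algebraicClasses_eq_top`), in `E`, granted the Riemann hypothesis for `ℙⁿ` in `E`.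
[cite: Kleiman1968, §3] -/
theorem standardConjectureD_projectiveSpace (hE : E.HasLefschetzTraceFormula)
    (hχ : ((χ (arithFrob k) : Kˣ) : K) = Nat.card k)
    (hRH : E.WeilRiemannHypothesisFor (projectiveSpace n k) n) :
    E.StandardConjectureD n (projectiveSpace n k) :=
  E.standardConjectureD_of_algebraicClasses_eq_top (isSmoothProjective_projectiveSpace_holds k n)
    (E.algebraicClasses_projectiveSpace_eq_top hE hχ hRH)

end ProjectiveSpace

/-! ### §3 The Betti numbers of `X × ℙⁿ`: the projective bundle formula -/

section ProjectiveSpaceOverBase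

variable {d n : ℕ} {X : SchemeOver k}

omit [Finite k] in
/-- `X × ℙⁿ` is smooth projective of dimension `d + n` when `X` is smooth projective of dimension `d` (the tree's
`IsSmoothProjective.tensor_holds` and `isSmoothProjective_projectiveSpace_holds`).
[cite: Hartshorne1977, III Prop. 10.1 (d) and II Ex. 4.9] -/
theorem isSmoothProjective_tensor_projectiveSpace (hX : IsSmoothProjective d X) (n : ℕ) :
    IsSmoothProjective (d + n) (X ⊗ projectiveSpace n k) :=
  IsSmoothProjective.tensor_holds hX (isSmoothProjective_projectiveSpace_holds k n)

/-- **The projective bundle ∕ Künneth formula in `E`: `b_i(X × ℙⁿ) = Σ_{a ≤ i/2, a ≤ n} b_{i−2a}(X)`**, for `E`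
with the Lefschetz trace formula and `χ(φ) = q`, `X` smooth projective of dimension `d`, granted the Riemann
hypothesis in `E` for `X` and for `X × ℙⁿ` — Göttsche's Remark 1.2.2 with `F(t, s) = (1 + t + ⋯ + tⁿ) s`
(`#(X × ℙⁿ)(𝔽_{q^m}) = (1 + q^m + ⋯ + q^{nm}) #X(𝔽_{q^m})`): «`p(X̄, −z) = F(z², p(S̄, −z))`», i.e.
`p(X × ℙⁿ, z) = (1 + z² + ⋯ + z^{2n}) p(X, z)` (the tree's `finrank_eq_of_pointCount_eq_eval_add_eval_mul` with
`A = 0`, `B = 1 + T + ⋯ + Tⁿ`). [cite: Gottsche1993, §1.2 Remark 1.2.2] -/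
theorem finrank_tensor_projectiveSpace (hE : E.HasLefschetzTraceFormula)
    (hχ : ((χ (arithFrob k) : Kˣ) : K) = Nat.card k) (hX : IsSmoothProjective d X)
    (hXRH : E.WeilRiemannHypothesisFor X d)
    (hRH : E.WeilRiemannHypothesisFor (X ⊗ projectiveSpace n k) (d + n)) (i : ℕ) :
    Module.finrank K (E.obj (X ⊗ projectiveSpace n k) i) =
      ∑ a ∈ Finset.range (i / 2 + 1), if a ≤ n then Module.finrank K (E.obj X (i - 2 * a)) else 0 := by
  have h := E.finrank_eq_of_pointCount_eq_eval_add_eval_mul hE hχ (isSmoothProjective_tensor_projectiveSpace hX n)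
    hRH hX hXRH 0 (∑ a ∈ Finset.range (n + 1), (Polynomial.X : ℚ[X]) ^ a)
    (fun _ hm => pointCount_tensor_projectiveSpace_cast X hm) i
  simp only [coeff_zero, ite_self, zero_add, coeff_sum_X_pow, ite_mul, one_mul, zero_mul] at h
  exact_mod_cast h

/-- **No odd cohomology for `X` ⟹ none for `X × ℙⁿ`** (in `E`, under the same hypotheses).
[cite: Gottsche1993, §1.2 Remark 1.2.2] -/
theorem finrank_tensor_projectiveSpace_eq_zero_of_odd (hE : E.HasLefschetzTraceFormula)
    (hχ : ((χ (arithFrob k) : Kˣ) : K) = Nat.card k) (hX : IsSmoothProjective d X)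
    (hXRH : E.WeilRiemannHypothesisFor X d)
    (hRH : E.WeilRiemannHypothesisFor (X ⊗ projectiveSpace n k) (d + n))
    (hodd : ∀ l : ℕ, Odd l → Module.finrank K (E.obj X l) = 0) {i : ℕ} (hi : Odd i) :
    Module.finrank K (E.obj (X ⊗ projectiveSpace n k) i) = 0 := by
  rw [E.finrank_tensor_projectiveSpace hE hχ hX hXRH hRH i]
  refine Finset.sum_eq_zero fun a ha => ?_
  split_ifs with han
  · obtain ⟨c, hc⟩ := hi
    exact hodd (i - 2 * a) ⟨c - a, by have := Finset.mem_range.mp ha; omega⟩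
  · rfl

/-- **`b_{2r}(X × ℙⁿ) ≥ b_{2r−2a}(X)`-type consequence: `b_0(X × ℙⁿ) = b_0(X)` and `b_1(X × ℙⁿ) = b_1(X)`**
(degrees `i < 2`: only `a = 0` contributes). [cite: Gottsche1993, §1.2 Remark 1.2.2] -/
theorem finrank_tensor_projectiveSpace_of_lt_two (hE : E.HasLefschetzTraceFormula)
    (hχ : ((χ (arithFrob k) : Kˣ) : K) = Nat.card k) (hX : IsSmoothProjective d X)
    (hXRH : E.WeilRiemannHypothesisFor X d)
    (hRH : E.WeilRiemannHypothesisFor (X ⊗ projectiveSpace n k) (d + n)) {i : ℕ} (hi : i < 2) :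
    Module.finrank K (E.obj (X ⊗ projectiveSpace n k) i) = Module.finrank K (E.obj X i) := by
  rw [E.finrank_tensor_projectiveSpace hE hχ hX hXRH hRH i, show i / 2 + 1 = 1 by omega, Finset.sum_range_one,
    if_pos (Nat.zero_le n), mul_zero, Nat.sub_zero]

end ProjectiveSpaceOverBase

end GaloisWeilCohomology

end Literature.AlgebraicGeometry.Motives
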